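import Literature.AlgebraicGeometry.Frobenioids.PerfectionUntrCommute
import Literature.AlgebraicGeometry.Frobenioids.UnitEquivalenceProofs
import Literature.AlgebraicGeometry.Frobenioids.Prop55Sub
import HarnessLib

/-!
# [FrdI] Prop. 5.5 (ii), first clause: `(C^pf)^un-tr ≅ (C^un-tr)^pf` is an equivalence (PROOFS)

[cite: MochizukiFrdI2008, Prop. 5.5 (ii) p.104]

Mochizuki, *The geometry of Frobenioids I*, Prop. 5.5 (ii) (p. 104; proof p. 105 ll. 1–8).  Continuing
`PerfectionUntrCommute.lean` (THE comparison functor `PerfectionUntr.comparison : (C^pf)^un-tr → (C^un-tr)^pf`,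
through `I = ι^pf : (C^istr)^pf → C^pf` and `U = j^pf : (C^istr)^pf → (C^un-tr)^pf`), this file proves print's
"natural bijections between the respective sets of morphisms":
* `unitEquiv_of_untrMap_map_eq` — "Prop. 3.2 (ii) applied to pre-steps and units", the other direction: if
  `U f = U g` then transports of representatives have the same image in `F_Φ`, hence (Prop. 3.3 (ii),
  `FrdI.Prop33ii_holds`) `t′ = γ ≫ β`, `s′ = γ ≫ δ ≫ β` with `δ ∈ O^×(Z)` in `C^istr`, and then `I f`, `I g` are
  unit-equivalent in `(C^pf)^istr` through the object `(Z, n·a)`;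
* the comparison functor is faithful (by the above), full (`U`, `I` are full) and essentially surjective, hence
  an equivalence (`comparison_isEquivalence`);
* the SLOT CLOSER `FrdI.Prop55Sub.Prop55ii_untr_holds` for the sub-statement `FrdI.Prop55Sub.Prop55ii_untr` of
  `Prop55Sub.lean` (cell abc-iut, sub-DAG FrdI:Prop5.5(ii)/P55-L03).
DISCLOSURE: the printed hypothesis "Frobenius-normalized type" is idle for (ii); "Frobenius-isotropic type" is
used. No statement of the paper is strengthened; nothing here bears on [IUTchIII] Cor. 3.12.
-/

namespace Literature.AlgebraicGeometry.Frobenioids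

open CategoryTheory Opposite

universe w v v' u u'

/-! ### Unit-equivalence is stable under composition on both sides -/

namespace PreFrobenioidData

variable {C : Type u} [Category.{v} C] {D : Type u'} [Category.{v'} D] (S : PreFrobenioidData.{w} C D)

/-- If `α₁ ≈^{O^×} α₂` then `x ≫ α₁ ≫ y ≈^{O^×} x ≫ α₂ ≫ y` (Def. 3.1 (iv): enlarge `γ`, `β`).
[cite: MochizukiFrdI2008, Def. 3.1 (iv) p.57] -/
theorem UnitEquiv.comp_left_right {A' A B B' : S.Istr} {α₁ α₂ : A ⟶ B} (h : S.UnitEquiv α₁ α₂)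
    (x : A' ⟶ A) (y : B ⟶ B') : S.UnitEquiv (x ≫ α₁ ≫ y) (x ≫ α₂ ≫ y) := by
  obtain ⟨X, γ, β, δ, hδ, rfl, rfl⟩ := h
  exact ⟨X, x ≫ γ, β ≫ y, δ, hδ, by simp only [Category.assoc], by simp only [Category.assoc]⟩

end PreFrobenioidData

namespace PreFrobenioid

variable {D : Type u} [Category.{v} D] {Φ : Dᵒᵖ ⥤ CommMonCat.{w}}
  {C : Type u'} [Category.{v'} C] {F : C ⥤ ElemFrobenioid Φ} {hF : IsFrobenioid F}

open PreFrobenioidData (ofFunctor)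

namespace PerfectionUntr

/-! ### `U f = U g` forces `I f ≈^{O^×} I g` -/

/-- **"Prop. 3.2 (ii) applied to pre-steps and units"**: if two arrows `f, g : P → Q` of `(C^istr)^pf` have the
same image under `U = j^pf`, then representatives `t′, s′ : A^{(a)} → B^{(b)}` at a common level have the same
class in `C^un-tr`, i.e. the same image in `F_Φ`, so (Prop. 3.3 (ii)) `t′ = γ ≫ β`, `s′ = γ ≫ δ ≫ β` with
`δ ∈ O^×(Z)`, `Z ∈ Ob(C^istr)`; in `C^pf` this reads `I f = Γ ≫ Β`, `I g = Γ ≫ Δ ≫ Β` through `(Z, n·a)` with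
`Δ = [frob⁻¹ ≫ δ ≫ frob] ∈ O^×((Z, n·a))`: the images are unit-equivalent in `(C^pf)^istr`.
[cite: MochizukiFrdI2008, Prop. 5.5 (ii) p.105] -/
theorem unitEquiv_of_untrMap_map_eq (hiso : IsOfType (IsFrobeniusIsotropic F))
    {P Q : Perfection (isFrobenioid_istr hF)} {f g : P ⟶ Q}
    (h : (untrMap hF).map f = (untrMap hF).map g)
    (hP : (Perfection.ops hF).isotropicObjects ((inclMap hF).obj P))
    (hQ : (Perfection.ops hF).isotropicObjects ((inclMap hF).obj Q)) :
    (Perfection.ops hF).UnitEquiv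
      (ObjectProperty.homMk ((inclMap hF).map f) : (⟨_, hP⟩ : (Perfection.ops hF).Istr) ⟶ ⟨_, hQ⟩)
      (ObjectProperty.homMk ((inclMap hF).map g)) := by
  obtain ⟨t, rfl⟩ := Perfection.Hom.mk_surjective f
  obtain ⟨s, rfl⟩ := Perfection.Hom.mk_surjective g
  -- `U[t] = U[s]`: the images of the transports to a common level `(a, b)` agree in `C^un-tr`
  unfold untrMap at h
  rw [Perfection.map_mk, Perfection.map_mk] at h
  obtain ⟨⟨a, b, eab⟩, h₁, h₂, hM⟩ := Perfection.Hom.mk_eq_mk.mp h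
  let M : Perfection.Level P Q := ⟨a, b, eab⟩
  have h₁' : t.L.LE M := ⟨h₁.1, h₁.2⟩
  have h₂' : s.L.LE M := ⟨h₂.1, h₂.2⟩
  set t₁ : frobPow (isFrobenioid_istr hF) P.obj a ⟶ frobPow (isFrobenioid_istr hF) Q.obj b :=
    Perfection.Level.lift t.L M h₁' t.hom with ht₁
  set s₁ : frobPow (isFrobenioid_istr hF) P.obj a ⟶ frobPow (isFrobenioid_istr hF) Q.obj b :=
    Perfection.Level.lift s.L M h₂' s.hom with hs₁
  have e₁ := Perfection.repMap_lift (hF₁ := isFrobenioid_istr hF) (hF₂ := isFrobenioid_untr hF)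
    (isFrobeniusCompatible_istrToUntr hF) t.L M h₁' t.hom
  have e₂ := Perfection.repMap_lift (hF₁ := isFrobenioid_istr hF) (hF₂ := isFrobenioid_untr hF)
    (isFrobeniusCompatible_istrToUntr hF) s.L M h₂' s.hom
  have hx : @Eq (frobPow (isFrobenioid_untr hF) ((istrToUntr F).obj P.obj) a ⟶
        frobPow (isFrobenioid_untr hF) ((istrToUntr F).obj Q.obj) b)
      (Perfection.repMap (hF₁ := isFrobenioid_istr hF) (hF₂ := isFrobenioid_untr hF)
        (isFrobeniusCompatible_istrToUntr hF) ⟨M, t₁⟩).hom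
      (Perfection.repMap (hF₁ := isFrobenioid_istr hF) (hF₂ := isFrobenioid_untr hF)
        (isFrobeniusCompatible_istrToUntr hF) ⟨M, s₁⟩).hom := by
    rw [ht₁, hs₁, e₁, e₂]
    exact hM
  rw [Perfection.repMap_hom, Perfection.repMap_hom, cancel_epi, cancel_mono] at hx
  -- Prop. 3.3 (ii): the unit-equivalence witness in `C^istr`
  have hx' := (toUntr_map_eq_iff hF
    ((ObjectProperty.ιOfLE (isotropicObjects_le_ofFunctor (F := F))).map t₁)
    ((ObjectProperty.ιOfLE (isotropicObjects_le_ofFunctor (F := F))).map s₁)).mp hx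
  obtain ⟨Z, γ, β, δ, hδ, eγβ, eγδβ⟩ := (FrdI.Prop33ii_holds F hF
    ((ObjectProperty.ιOfLE (isotropicObjects_le_ofFunctor (F := F))).map t₁)
    ((ObjectProperty.ιOfLE (isotropicObjects_le_ofFunctor (F := F))).map s₁)).mpr
    ⟨congrArg ElemFrobenioid.Hom.degFr hx', congrArg ElemFrobenioid.Hom.div hx',
      congrArg ElemFrobenioid.Hom.base hx'⟩
  -- the atoms, with their types in one syntactic form
  let γ' : (frobPow (isFrobenioid_istr hF) P.obj a).obj ⟶ Z.obj := γ.hom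
  let β' : Z.obj ⟶ (frobPow (isFrobenioid_istr hF) Q.obj b).obj := β.hom
  let δ' : Z.obj ⟶ Z.obj := δ.hom
  have et : t₁.hom = γ' ≫ β' := by
    have e := congrArg (fun φ => φ.hom) eγβ
    simp only [ObjectProperty.ιOfLE_map, ObjectProperty.homMk_hom,
      ObjectProperty.FullSubcategory.comp_hom] at e
    exact e
  have es : s₁.hom = γ' ≫ δ' ≫ β' := by
    have e := congrArg (fun φ => φ.hom) eγδβ
    simp only [ObjectProperty.ιOfLE_map, ObjectProperty.homMk_hom,
      ObjectProperty.FullSubcategory.comp_hom] at e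
    exact e
  have hδb : Base F δ' = 𝟙 _ := hδ.1
  have hδl : PreFrobenioid.degFr F δ' = 1 := hδ.2
  -- the picture in `C^pf`, through the object `(Z, n·a)`
  haveI := Perfection.isIso_frob_one (hF := hF) Z.obj
  let IP : Perfection hF := (inclMap hF).obj P
  let IQ : Perfection hF := (inclMap hF).obj Q
  let Zp : Perfection hF := ⟨Z.obj, P.idx * a⟩
  let T : Perfection.Level₃ IP Zp IQ := ⟨a, 1, b, (mul_one _).symm, by rw [mul_one]; exact eab⟩
  let jAi : frobPow hF P.obj.obj a ⟶ (frobPow (isFrobenioid_istr hF) P.obj a).obj :=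
    (Perfection.frobPowIso (hF₁ := isFrobenioid_istr hF) (hF₂ := hF) (isFrobeniusCompatible_istrι hF)
      P.obj a).inv
  let jBh : (frobPow (isFrobenioid_istr hF) Q.obj b).obj ⟶ frobPow hF Q.obj.obj b :=
    (Perfection.frobPowIso (hF₁ := isFrobenioid_istr hF) (hF₂ := hF) (isFrobeniusCompatible_istrι hF)
      Q.obj b).hom
  let fZ : Z.obj ⟶ frobPow hF Z.obj 1 := frob hF Z.obj 1
  let rΓ : Perfection.Rep IP Zp := ⟨T.fst, jAi ≫ γ' ≫ fZ⟩
  let rΒ : Perfection.Rep Zp IQ := ⟨T.snd, inv fZ ≫ β' ≫ jBh⟩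
  let θ : frobPow hF Zp.obj 1 ⟶ frobPow hF Zp.obj 1 := inv fZ ≫ δ' ≫ fZ
  -- `Δ = [frob⁻¹ ≫ δ ≫ frob]` is a unit of `(Z, n·a)`
  haveI hΔiso : IsIso (Perfection.endClass Zp 1 θ) :=
    Perfection.isIso_mk_of_isIso _ (by change IsIso θ; infer_instance)
  have hΔ : asIso (Perfection.endClass Zp 1 θ) ∈ (Perfection.ops hF).unitsSubgroup Zp := by
    refine ⟨(Perfection.isBaseIdentity_endClass_iff Zp 1 θ).mpr ?_,
      (Perfection.isLinear_endClass_iff Zp 1 θ).mpr ?_⟩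
    · change Base F θ = 𝟙 _
      rw [base_comp, base_comp, hδb, Category.id_comp, ← base_comp, IsIso.inv_hom_id, base_id]
    · change PreFrobenioid.degFr F θ = 1
      rw [degFr_iso_comp, degFr_comp_iso, hδl]
  -- `I[t] = Γ ≫ Β`
  have cΓΒ : (inclMap hF).map (Perfection.Hom.mk t) =
      (Perfection.Hom.mk rΓ ≫ Perfection.Hom.mk rΒ : IP ⟶ IQ) := by
    rw [← Perfection.Hom.mk_lift t M h₁']
    unfold inclMap
    rw [Perfection.map_mk, Perfection.mk_comp_mk,
      ← Perfection.mk_compAt T rΓ rΒ (Perfection.Level.le_rfl _) (Perfection.Level.le_rfl _)]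
    apply Perfection.Hom.mk_eq_mk.mpr
    refine ⟨T.out, Perfection.Level.le_rfl _, Perfection.Level.le_rfl _, ?_⟩
    unfold Perfection.repMap Perfection.compAt
    change Perfection.Level.lift T.out T.out (Perfection.Level.le_rfl _) (jAi ≫ t₁.hom ≫ jBh) =
      Perfection.Level.lift T.out T.out (Perfection.Level.le_rfl _)
        (Perfection.Level.lift T.fst T.fst (Perfection.Level.le_rfl _) (jAi ≫ γ' ≫ fZ) ≫
          Perfection.Level.lift T.snd T.snd (Perfection.Level.le_rfl _) (inv fZ ≫ β' ≫ jBh))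
    rw [Perfection.Level.lift_rfl, Perfection.Level.lift_rfl, Perfection.Level.lift_rfl,
      Perfection.Level.lift_rfl, et]
    simp only [Category.assoc, IsIso.hom_inv_id_assoc]
  -- `I[s] = Γ ≫ Δ ≫ Β`
  have cΓΔΒ : (inclMap hF).map (Perfection.Hom.mk s) =
      (Perfection.Hom.mk rΓ ≫ Perfection.endClass Zp 1 θ ≫ Perfection.Hom.mk rΒ : IP ⟶ IQ) := by
    -- first `Δ ≫ Β`
    let T₂ : Perfection.Level₃ Zp Zp IQ := ⟨1, 1, b, rfl, T.eq₂⟩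
    let rΔΒ : Perfection.Rep Zp IQ := ⟨T.snd, inv fZ ≫ δ' ≫ β' ≫ jBh⟩
    have cΔΒ : (Perfection.endClass Zp 1 θ ≫ Perfection.Hom.mk rΒ : Zp ⟶ IQ) = Perfection.Hom.mk rΔΒ := by
      rw [Perfection.endClass_def, Perfection.mk_comp_mk,
        ← Perfection.mk_compAt T₂ ⟨Perfection.Level.diag Zp 1, θ⟩ rΒ (Perfection.Level.le_rfl _)
          (Perfection.Level.le_rfl _)]
      apply Perfection.Hom.mk_eq_mk.mpr
      refine ⟨T.snd, Perfection.Level.le_rfl _, Perfection.Level.le_rfl _, ?_⟩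
      unfold Perfection.compAt
      change Perfection.Level.lift T.snd T.snd (Perfection.Level.le_rfl _)
          (Perfection.Level.lift (Perfection.Level.diag Zp 1) (Perfection.Level.diag Zp 1)
              (Perfection.Level.le_rfl _) (inv fZ ≫ δ' ≫ fZ) ≫
            Perfection.Level.lift T.snd T.snd (Perfection.Level.le_rfl _) (inv fZ ≫ β' ≫ jBh)) =
        Perfection.Level.lift T.snd T.snd (Perfection.Level.le_rfl _) (inv fZ ≫ δ' ≫ β' ≫ jBh)
      rw [Perfection.Level.lift_rfl, Perfection.Level.lift_rfl, Perfection.Level.lift_rfl,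
        Perfection.Level.lift_rfl]
      simp only [Category.assoc, IsIso.hom_inv_id_assoc]
    rw [cΔΒ, ← Perfection.Hom.mk_lift s M h₂']
    unfold inclMap
    rw [Perfection.map_mk, Perfection.mk_comp_mk,
      ← Perfection.mk_compAt T rΓ rΔΒ (Perfection.Level.le_rfl _) (Perfection.Level.le_rfl _)]
    apply Perfection.Hom.mk_eq_mk.mpr
    refine ⟨T.out, Perfection.Level.le_rfl _, Perfection.Level.le_rfl _, ?_⟩
    unfold Perfection.repMap Perfection.compAt
    change Perfection.Level.lift T.out T.out (Perfection.Level.le_rfl _) (jAi ≫ s₁.hom ≫ jBh) =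
      Perfection.Level.lift T.out T.out (Perfection.Level.le_rfl _)
        (Perfection.Level.lift T.fst T.fst (Perfection.Level.le_rfl _) (jAi ≫ γ' ≫ fZ) ≫
          Perfection.Level.lift T.snd T.snd (Perfection.Level.le_rfl _) (inv fZ ≫ δ' ≫ β' ≫ jBh))
    rw [Perfection.Level.lift_rfl, Perfection.Level.lift_rfl, Perfection.Level.lift_rfl,
      Perfection.Level.lift_rfl, es]
    simp only [Category.assoc, IsIso.hom_inv_id_assoc]
  -- assemble the unit-equivalence in `(C^pf)^istr`
  have hZp : (Perfection.ops hF).isotropicObjects Zp := (Perfection.isOfIsotropicType_perfection hF hiso).obj Zp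
  refine ⟨⟨Zp, hZp⟩, ObjectProperty.homMk (Perfection.Hom.mk rΓ : IP ⟶ Zp),
    ObjectProperty.homMk (Perfection.Hom.mk rΒ : Zp ⟶ IQ), asIso (Perfection.endClass Zp 1 θ), hΔ, ?_, ?_⟩
  · ext
    simp only [ObjectProperty.homMk_hom, ObjectProperty.FullSubcategory.comp_hom]
    exact cΓΒ
  · ext
    simp only [ObjectProperty.homMk_hom, ObjectProperty.FullSubcategory.comp_hom, asIso_hom]
    exact cΓΔΒ

section Equivalence

variable (hiso : IsOfType (IsFrobeniusIsotropic F))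

/-! ### The comparison functor is an equivalence -/

/-- **The comparison functor is faithful**: classes with the same image have unit-equivalent representatives
(`unitEquiv_of_untrMap_map_eq`, conjugated back along the chosen isomorphisms `c_X : I P_X ≅ X`).
[cite: MochizukiFrdI2008, Prop. 5.5 (ii) p.105] -/
theorem comparison_faithful : (comparison hF hiso).Faithful := by
  refine ⟨fun {X Y} φ₁ φ₂ h => ?_⟩
  obtain ⟨u₁, rfl⟩ := (Perfection.ops hF).toUntr.map_surjective φ₁
  obtain ⟨u₂, rfl⟩ := (Perfection.ops hF).toUntr.map_surjective φ₂
  have h' : (untrMap hF).map (preHom hF hiso u₁.hom) = (untrMap hF).map (preHom hF hiso u₂.hom) := h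
  have key := unitEquiv_of_untrMap_map_eq hiso h'
    ((Perfection.isOfIsotropicType_perfection hF hiso).obj _)
    ((Perfection.isOfIsotropicType_perfection hF hiso).obj _)
  rw [inclMap_map_preHom, inclMap_map_preHom] at key
  have key' := PreFrobenioidData.UnitEquiv.comp_left_right _ key
    ((Perfection.ops hF).isotropicObjects.isoMk (preIso hF hiso X.as.obj) :
      (⟨_, (Perfection.isOfIsotropicType_perfection hF hiso).obj _⟩ : (Perfection.ops hF).Istr) ≅ X.as).inv
    ((Perfection.ops hF).isotropicObjects.isoMk (preIso hF hiso Y.as.obj) :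
      (⟨_, (Perfection.isOfIsotropicType_perfection hF hiso).obj _⟩ : (Perfection.ops hF).Istr) ≅ Y.as).hom
  have e₁ : ((Perfection.ops hF).isotropicObjects.isoMk (preIso hF hiso X.as.obj) :
      (⟨_, (Perfection.isOfIsotropicType_perfection hF hiso).obj _⟩ : (Perfection.ops hF).Istr) ≅ X.as).inv ≫
      (ObjectProperty.homMk ((preIso hF hiso X.as.obj).hom ≫ u₁.hom ≫ (preIso hF hiso Y.as.obj).inv) :
        (⟨_, (Perfection.isOfIsotropicType_perfection hF hiso).obj _⟩ : (Perfection.ops hF).Istr) ⟶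
          ⟨_, (Perfection.isOfIsotropicType_perfection hF hiso).obj _⟩) ≫
      ((Perfection.ops hF).isotropicObjects.isoMk (preIso hF hiso Y.as.obj) :
      (⟨_, (Perfection.isOfIsotropicType_perfection hF hiso).obj _⟩ : (Perfection.ops hF).Istr) ≅ Y.as).hom = u₁ := by
    ext
    simp only [ObjectProperty.FullSubcategory.comp_hom, ObjectProperty.isoMk_inv, ObjectProperty.isoMk_hom,
      ObjectProperty.homMk_hom, Category.assoc, Iso.inv_hom_id, Category.comp_id, Iso.inv_hom_id_assoc]
  have e₂ : ((Perfection.ops hF).isotropicObjects.isoMk (preIso hF hiso X.as.obj) :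
      (⟨_, (Perfection.isOfIsotropicType_perfection hF hiso).obj _⟩ : (Perfection.ops hF).Istr) ≅ X.as).inv ≫
      (ObjectProperty.homMk ((preIso hF hiso X.as.obj).hom ≫ u₂.hom ≫ (preIso hF hiso Y.as.obj).inv) :
        (⟨_, (Perfection.isOfIsotropicType_perfection hF hiso).obj _⟩ : (Perfection.ops hF).Istr) ⟶
          ⟨_, (Perfection.isOfIsotropicType_perfection hF hiso).obj _⟩) ≫
      ((Perfection.ops hF).isotropicObjects.isoMk (preIso hF hiso Y.as.obj) :
      (⟨_, (Perfection.isOfIsotropicType_perfection hF hiso).obj _⟩ : (Perfection.ops hF).Istr) ≅ Y.as).hom = u₂ := by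
    ext
    simp only [ObjectProperty.FullSubcategory.comp_hom, ObjectProperty.isoMk_inv, ObjectProperty.isoMk_hom,
      ObjectProperty.homMk_hom, Category.assoc, Iso.inv_hom_id, Category.comp_id, Iso.inv_hom_id_assoc]
  rw [e₁, e₂] at key'
  exact CategoryTheory.Quotient.sound _ key'

/-- **The comparison functor is full**: an arrow `U P_X → U P_Y` is `U f` (`U` is full), and
`[c_X⁻¹ ≫ I f ≫ c_Y]` maps to it. [cite: MochizukiFrdI2008, Prop. 5.5 (ii) p.105] -/
theorem comparison_full : (comparison hF hiso).Full := by
  refine ⟨fun {X Y} θ => ?_⟩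
  haveI := untrMap_full (hF := hF)
  haveI := inclMap_faithful (hF := hF)
  obtain ⟨f, hf⟩ := (untrMap hF).map_surjective
    (θ : (untrMap hF).obj (pre hF hiso X.as.obj) ⟶ (untrMap hF).obj (pre hF hiso Y.as.obj))
  let u : X.as ⟶ Y.as :=
    ObjectProperty.homMk ((preIso hF hiso X.as.obj).inv ≫ (inclMap hF).map f ≫ (preIso hF hiso Y.as.obj).hom)
  refine ⟨(Perfection.ops hF).toUntr.map u, ?_⟩
  change (untrMap hF).map (preHom hF hiso u.hom) = θ
  rw [← hf]
  congr 1
  apply (inclMap hF).map_injective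
  rw [inclMap_map_preHom]
  simp only [u, ObjectProperty.homMk_hom, Category.assoc, Iso.hom_inv_id, Category.comp_id,
    Iso.hom_inv_id_assoc]

/-- **The comparison functor is essentially surjective**: `([A], n) = U(A, n)` for `A ∈ Ob(C^istr)`, and the
class of `(A, n) = I(A, n)` maps to `U(P_{(A, n)}) ≅ U(A, n)` (`I⁻¹ c : P_{(A,n)} ≅ (A, n)`).
[cite: MochizukiFrdI2008, Prop. 5.5 (ii) p.105] -/
theorem comparison_essSurj : (comparison hF hiso).EssSurj := by
  refine ⟨fun Y => ?_⟩
  haveI := inclMap_full (hF := hF)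
  haveI := inclMap_faithful (hF := hF)
  obtain ⟨X, n⟩ := Y
  have hX : IsIsotropic F X.as.obj := (PreFrobenioidData.ofFunctor_isIsotropic F _).mp X.as.property
  let P : Perfection (isFrobenioid_istr hF) := ⟨⟨X.as.obj, hX⟩, n⟩
  have hP : (untrMap hF).obj P = ⟨X, n⟩ := rfl
  let IP : (Perfection.ops hF).Istr :=
    ⟨(inclMap hF).obj P, (Perfection.isOfIsotropicType_perfection hF hiso).obj _⟩
  refine ⟨(Perfection.ops hF).toUntr.obj IP, ⟨?_⟩⟩
  exact (untrMap hF).mapIso ((inclMap hF).preimageIso (preIso hF hiso ((inclMap hF).obj P))) ≪≫ eqToIso hP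

/-- **[FrdI] Prop. 5.5 (ii), first clause — THE comparison functor `(C^pf)^un-tr → (C^un-tr)^pf` is an
equivalence of categories** (for `C` of Frobenius-isotropic type). [cite: MochizukiFrdI2008, Prop. 5.5 (ii) p.104] -/
theorem comparison_isEquivalence : (comparison hF hiso).IsEquivalence :=
  haveI := comparison_faithful (hF := hF) hiso
  haveI := comparison_full (hF := hF) hiso
  haveI := comparison_essSurj (hF := hF) hiso
  { }

end Equivalence

end PerfectionUntr

/-! ### The slot of `Prop55Sub.lean` -/

/-- **[FrdI] Prop. 5.5 (ii), first clause**, at the exact shape of the sub-statement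
`FrdI.Prop55Sub.Prop55ii_untr` over THE constructions: for `C` of Frobenius-isotropic (and Frobenius-normalized —
idle) type, an equivalence `(C^pf)^un-tr ≌ (C^un-tr)^pf` lying over `D`.
[cite: MochizukiFrdI2008, Prop. 5.5 (ii) p.104] -/
theorem prop55ii_untr (hF : IsFrobenioid F) (hiso : IsOfType (IsFrobeniusIsotropic F)) :
    ∃ e : (Perfection.ops hF).Untr ≌ PreFrobenioid.Perfection (isFrobenioid_untr hF),
      ∀ hPf : IsFrobenioid (Perfection.ops hF).toFunctor,
        Nonempty (e.functor ⋙ (Perfection.ops (isFrobenioid_untr hF)).base ≅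
          (PreFrobenioidData.ofFunctor _ (untrFunctor hPf)).base) :=
  haveI := PerfectionUntr.comparison_isEquivalence (hF := hF) hiso
  ⟨(PerfectionUntr.comparison hF hiso).asEquivalence,
    fun hPf => ⟨PerfectionUntr.comparisonCompBaseIso hF hiso hPf⟩⟩

end PreFrobenioid

namespace FrdI.Prop55Sub

variable {D : Type u} [Category.{v} D] {Φ : Dᵒᵖ ⥤ CommMonCat.{w}}
  {C : Type u'} [Category.{v'} C] {F : C ⥤ ElemFrobenioid Φ}

/-- **SLOT CLOSER for `FrdI.Prop55Sub.Prop55ii_untr`** ([FrdI] Prop. 5.5 (ii), first clause, sub-DAG node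
FrdI:Prop5.5(ii)/P55-L03 of cell abc-iut): for every Frobenioid `F : C → F_Φ`, the named statement
`Prop55ii_untr F hF` of `Prop55Sub.lean` holds. [cite: MochizukiFrdI2008, Prop. 5.5 (ii) p.104] -/
theorem Prop55ii_untr_holds :
    ∀ hF : PreFrobenioid.IsFrobenioid F,
      Literature.AlgebraicGeometry.Frobenioids.FrdI.Prop55Sub.Prop55ii_untr F hF :=
  fun hF hiso _ => PreFrobenioid.prop55ii_untr hF hiso

end FrdI.Prop55Sub

end Literature.AlgebraicGeometry.Frobenioids
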